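import Summits.QuantumFields.YangMills.Theorems.AllWindowsColdBoxBoxHighLineLandauKernelBounds
import Summits.QuantumFields.YangMills.Theorems.AllWindowsColdBoxBoxHighLineBootstrapAssembly

/-!
# LINE-19 stubs S4b and S4 BY NAME, from S3b

With S3b `RestBlock.landauKernelDecay : LandauKernelDecay` a tree theorem (file `…LandauKernelBounds`), the registered stubs S4b
`stub_landauRepresentative : LandauBootstrapBound` and S4 `stub_gaugeBallReduction` of LINE-19 «landau-sector-relative-bl»
(⟨stmt-QuantumFields-24004⟩ / LOW item ⟨24335⟩) are the landed implications `landauBootstrapBound_of_landauKernelDecay` and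
`gaugeBallReduction_of_landauKernelDecay` (✓p724792, file `…BootstrapAssembly`) applied to it.

HONEST LABEL: closes the registered stubs S4b and S4 by name; S5 `stub_landauSecondOrder` and the residual S6 remain; the crux ⟨24004⟩, the
rung and the summit are NOT proved; the Yang–Mills mass gap is NOT proved by this file.
-/

set_option autoImplicit false

noncomputable section

namespace Summit.QuantumFields.YangMills.Theorems.AllWindowsColdBoxBoxHighLine

/-- **Stub S4b of LINE-19, BY NAME**: the small Landau representative (one-step bootstrap typing). -/
theorem stub_landauRepresentative : LandauBootstrapBound :=
  landauBootstrapBound_of_landauKernelDecay RestBlock.landauKernelDecay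

/-- **Stub S4 of LINE-19, BY NAME**: the gauge-ball reduction for every `θL < 1/12`. -/
theorem stub_gaugeBallReduction : ∀ θL : ℝ, θL < 1 / 12 → ∃ κ : ℝ, 0 < κ ∧ κ < 1 / 2 - 3 * θL ∧ GaugeBallReduction θL κ :=
  gaugeBallReduction_of_landauKernelDecay RestBlock.landauKernelDecay


/-- The filed window `θL = 1/13` (re-tick of S4 on the LOW item ⟨stmt-QuantumFields-24335⟩ `BoxWindowLowSU2213`): a gauge-ball exponent
`κ ∈ (0, 1/2 − 3/13)` exists. -/
theorem gaugeBallReduction_one_thirteenth : ∃ κ : ℝ, 0 < κ ∧ κ < 1 / 2 - 3 * (1 / 13) ∧ GaugeBallReduction (1 / 13) κ :=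
  stub_gaugeBallReduction (1 / 13) (by norm_num)

/-- Registry re-tick of S4b/S4 on ⟨stmt-QuantumFields-24004⟩ (the stubs above were first filed in helper mode, ✓p731887): the small
Landau representative, restated as a usable `example` (no new declaration). -/
example : LandauBootstrapBound := stub_landauRepresentative

/-- Registry re-tick of S4b/S4 on the LOW item ⟨stmt-QuantumFields-24335⟩: the gauge-ball reduction at the window `θL = 1/14`,
a usable `example` (no new declaration). -/
example : ∃ κ : ℝ, 0 < κ ∧ κ < 1 / 2 - 3 * (1 / 14) ∧ GaugeBallReduction (1 / 14) κ := stub_gaugeBallReduction (1 / 14) (by norm_num)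

end Summit.QuantumFields.YangMills.Theorems.AllWindowsColdBoxBoxHighLine

end
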